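import Mathlib
import Literature.MathematicalPhysics.QuantumLattice.HubbardBandSectorCountingToolbox
import Summits.HubbardSuperconductivity.HubbardSuperconductivity.Theorems.KLProgrammeKLRegimeTwoPointLimitShellTransversality
import Summits.HubbardSuperconductivity.HubbardSuperconductivity.Theorems.KLProgrammeKLRegimeTwoPointLimitShellCountTools
import HarnessLib

/-!
# Route `KLProgramme` — crux K3 `KLRegimeTwoPointLimit` (stmt-HubbardSuperconductivity-19937), support:
# at most three intersection points near the Cooper point (DECOMP App. E Lemma E.1, count in the
# freezing regime)

Cell `gate-hubbard-kl`, seat p1b (C1 second hand); paper note `HOME/prover-p1b/E1-NOTE.md` §3 Lemma 7 (i).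

For a SMALL transfer `w` (the Cooper regime `|w|_𝕋 → 0`, where the particle–particle bubble is
marginal and Lemma E.4's freezing argument lives) the band Fermi curve `F_μ` and its translate
`F_μ + w` nearly coincide, the crossing slope is only `≍ |w|` (`klst_slope_lower_bound`), and a
spacing argument would give `O(1/|w|)` intersection points. The sharp count is `2` (two translates of
a strictly convex curve meet twice); this file proves the uniform bound `3` per period WITHOUT convex
geometry, from the Gauss map: expanding `G_w(θ) = ε(p_μ(θ) - w) - μ` to first order in `w`
(`klcc_transLevel_taylor`: `G_w = -2(w₁ sin X + w₂ sin Y) + O(|w|²)`, and `(sin X, sin Y) = ρ(cos α, sin α)`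
with `α` the normal angle), the zeros lie where `cos(α(θ) - ψ_w) = O(|w|)`, i.e. where `α(θ)` is
within `O(|w|)` of `ψ_w + π/2 + kπ`; on each such arc the slope bound makes `G_w` strictly monotone
(one zero per `k`), and since `α` is strictly increasing with `α(θ + 2π) = α(θ) + 2π`, a period meets
at most three of the arcs (`klcc_zeros_card_le_three`). The transversality constants are passed
through as hypotheses in the exact shape of `klst_slope_lower_bound`; the assembly file instantiates
them with `λ ≍ |w|`.

What is deliberately NOT here: the count away from the Cooper point (windows at the caustic), the
area assembly.
-/

noncomputable section

-- the tree's namespace `Summit.<Summit>.<Problem>.Theorems` repeats the summit name by design (D-0017)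
set_option linter.dupNamespace false

open Real Set
open Literature.MathematicalPhysics.QuantumLattice
open Literature.MathematicalPhysics.QuantumLattice.BandSectorCounting

namespace Summit.HubbardSuperconductivity.HubbardSuperconductivity.Theorems

/-! ### Elementary trigonometric tools -/

/-- Second-order Taylor bound for the cosine: `|cos(x - h) - cos x - h sin x| ≤ h²/2`. -/
theorem klcc_abs_cos_sub_taylor (x h : ℝ) :
    |Real.cos (x - h) - Real.cos x - h * Real.sin x| ≤ h ^ 2 / 2 := by
  have h0 := klst_abs_taylor_two_le (g := Real.cos) (g' := fun t => -Real.sin t)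
    (g'' := fun t => -Real.cos t) (fun t => Real.hasDerivAt_cos t)
    (fun t => (Real.hasDerivAt_sin t).neg) (A := 1)
    (fun t => by rw [abs_neg]; exact Real.abs_cos_le_one t) x (x - h)
  have e : Real.cos (x - h) - Real.cos x - -Real.sin x * (x - h - x) =
      Real.cos (x - h) - Real.cos x - h * Real.sin x := by ring
  rw [e] at h0
  calc |Real.cos (x - h) - Real.cos x - h * Real.sin x| ≤ 1 / 2 * (x - h - x) ^ 2 := h0
    _ = h ^ 2 / 2 := by ring

/-- `|(-1)^k| = 1` for an integer exponent. -/
theorem klcc_abs_neg_one_zpow (k : ℤ) : |((-1 : ℝ)) ^ k| = 1 := by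
  rw [abs_zpow, abs_neg, abs_one, one_zpow]

/-- Every real `y` is within `(π/2)|sin y|` of an integer multiple of `π` (Jordan's inequality at the
nearest multiple). -/
theorem klcc_exists_int_abs_sub_mul_pi_le (y : ℝ) :
    ∃ k : ℤ, |y - k * π| ≤ π / 2 * |Real.sin y| := by
  have hπ := Real.pi_pos
  set k := round (y / π) with hk
  refine ⟨k, ?_⟩
  set t := y - k * π with ht
  have hround := abs_sub_round (y / π)
  have htle : |t| ≤ π / 2 := by
    have : t = (y / π - round (y / π)) * π := by rw [ht, hk]; field_simp
    rw [this, abs_mul, abs_of_pos hπ]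
    nlinarith [hround]
  have hsin : |Real.sin y| = |Real.sin t| := by
    have : y = t + k * π := by rw [ht]; ring
    rw [this, Real.sin_add_int_mul_pi, abs_mul, klcc_abs_neg_one_zpow, one_mul]
  rw [hsin]
  -- Jordan: `(2/π)|t| ≤ |sin t|` for `|t| ≤ π/2`
  have key : 2 / π * |t| ≤ |Real.sin t| := by
    rcases le_or_gt 0 t with h0 | h0
    · rw [abs_of_nonneg h0]
      have h1 := Real.mul_le_sin h0 (by rwa [abs_of_nonneg h0] at htle)
      exact h1.trans (le_abs_self _)
    · rw [abs_of_neg h0]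
      have h0' : 0 ≤ -t := by linarith
      have h1 := Real.mul_le_sin h0' (by rwa [abs_of_neg h0] at htle)
      rw [Real.sin_neg] at h1
      exact h1.trans (neg_le_abs _)
  rw [div_mul_eq_mul_div, div_le_iff₀ hπ] at key
  nlinarith [key, abs_nonneg t]

/-- Polar decomposition of a nonzero transfer: `w = |w| (cos ψ, sin ψ)`. -/
theorem klcc_exists_polar {w₁ w₂ : ℝ} (hw : 0 < Real.sqrt (w₁ ^ 2 + w₂ ^ 2)) :
    ∃ ψ : ℝ, w₁ = Real.sqrt (w₁ ^ 2 + w₂ ^ 2) * Real.cos ψ ∧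
      w₂ = Real.sqrt (w₁ ^ 2 + w₂ ^ 2) * Real.sin ψ := by
  set z : ℂ := ⟨w₁, w₂⟩ with hz
  have hnorm : ‖z‖ = Real.sqrt (w₁ ^ 2 + w₂ ^ 2) := by
    rw [Complex.norm_def, Complex.normSq_apply]; congr 1; simp [hz]; ring
  have hz0 : z ≠ 0 := by
    intro h0; rw [h0, norm_zero] at hnorm; linarith
  refine ⟨Complex.arg z, ?_, ?_⟩
  · have h := Complex.cos_arg hz0
    rw [hnorm] at h
    have : z.re = w₁ := rfl
    rw [this] at h
    rw [h]; field_simp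
  · have h := Complex.sin_arg z
    rw [hnorm] at h
    have : z.im = w₂ := rfl
    rw [this] at h
    rw [h]; field_simp

/-! ### First-order expansion of the translated level function in the transfer -/

section Level

variable {μ : ℝ} (hμ₁ : -4 < μ) (hμ₂ : μ < 0)
include hμ₁ hμ₂

/-- `G_w(θ) = ε(p_μ(θ) - w) - μ = -2(w₁ sin X(θ) + w₂ sin Y(θ)) + R` with `|R| ≤ w₁² + w₂²`
(the curve lies on the level `μ`; cosine Taylor in each coordinate). -/
theorem klcc_transLevel_taylor (w₁ w₂ θ : ℝ) :
    |eps2 (bandX μ θ - w₁) (bandY μ θ - w₂) - μ +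
        2 * (w₁ * Real.sin (bandX μ θ) + w₂ * Real.sin (bandY μ θ))| ≤ w₁ ^ 2 + w₂ ^ 2 := by
  have hcurve : eps2 (bandX μ θ) (bandY μ θ) = μ := eps2_bandXY hμ₁ hμ₂ θ
  have h1 := klcc_abs_cos_sub_taylor (bandX μ θ) w₁
  have h2 := klcc_abs_cos_sub_taylor (bandY μ θ) w₂
  have e : eps2 (bandX μ θ - w₁) (bandY μ θ - w₂) - μ +
      2 * (w₁ * Real.sin (bandX μ θ) + w₂ * Real.sin (bandY μ θ)) =
      (-2) * ((Real.cos (bandX μ θ - w₁) - Real.cos (bandX μ θ) - w₁ * Real.sin (bandX μ θ)) +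
        (Real.cos (bandY μ θ - w₂) - Real.cos (bandY μ θ) - w₂ * Real.sin (bandY μ θ))) +
      (eps2 (bandX μ θ) (bandY μ θ) - μ) := by
    simp only [eps2]; ring
  rw [e, hcurve, sub_self, add_zero, abs_mul, abs_neg, abs_two]
  have := abs_add_le (Real.cos (bandX μ θ - w₁) - Real.cos (bandX μ θ) - w₁ * Real.sin (bandX μ θ))
    (Real.cos (bandY μ θ - w₂) - Real.cos (bandY μ θ) - w₂ * Real.sin (bandY μ θ))
  nlinarith [this, h1, h2, abs_nonneg (Real.cos (bandX μ θ - w₁) - Real.cos (bandX μ θ) -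
    w₁ * Real.sin (bandX μ θ) + (Real.cos (bandY μ θ - w₂) - Real.cos (bandY μ θ) -
    w₂ * Real.sin (bandY μ θ)))]

/-- `α(θ + 2π) = α(θ) + 2π` for the band normal angle. -/
theorem klcc_bandNormalAngle_add_two_pi (θ : ℝ) :
    bandNormalAngle μ (θ + 2 * π) = bandNormalAngle μ θ + 2 * π := by
  have h1 := bandNormalAngle_add_pi hμ₁ hμ₂ θ
  have h2 := bandNormalAngle_add_pi hμ₁ hμ₂ (θ + π)
  rw [show θ + 2 * π = θ + π + π by ring, h2, h1]; ring

end Level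

/-! ### The count near the Cooper point -/

section Main

variable {a b : ℝ} (B : BandBounds a b) {μ : ℝ} (hμ : μ ∈ Icc a b)
include B hμ

/-- The gradient modulus `ρ(θ) = √(sin²X + sin²Y)` of the polar form equals the `ρ` of
`sin_bandXY_eq_polar`; we record the consequences `ρ ≥ ρ_min` and `ρ ≤ √2` in the form used below. -/
theorem klcc_polar_rho_bounds {θ ρ : ℝ} (hρ : 0 < ρ)
    (hx : Real.sin (bandX μ θ) = ρ * Real.cos (bandNormalAngle μ θ))
    (hy : Real.sin (bandY μ θ) = ρ * Real.sin (bandNormalAngle μ θ)) :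
    B.rhomin ≤ ρ ∧ ρ ≤ Real.sqrt 2 := by
  have hρ2 : Real.sin (bandX μ θ) ^ 2 + Real.sin (bandY μ θ) ^ 2 = ρ ^ 2 := by
    rw [hx, hy]; nlinarith [Real.cos_sq_add_sin_sq (bandNormalAngle μ θ)]
  have hsq : Real.sqrt (Real.sin (bandX μ θ) ^ 2 + Real.sin (bandY μ θ) ^ 2) = ρ := by
    rw [hρ2, Real.sqrt_sq hρ.le]
  refine ⟨by have := B.rho_ge μ hμ θ; rwa [hsq] at this, ?_⟩
  have : ρ ^ 2 ≤ 2 := by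
    rw [← hρ2]; nlinarith [Real.sin_sq_le_one (bandX μ θ), Real.sin_sq_le_one (bandY μ θ)]
  calc ρ = Real.sqrt (ρ ^ 2) := (Real.sqrt_sq hρ.le).symm
    _ ≤ Real.sqrt 2 := Real.sqrt_le_sqrt this

/-- On an arc where the normal angle `α(θ)` is within `(π/2)s` of `ψ_w + π/2 + kπ`, the translated
level function is small: `|G_w(θ)| ≤ √2·π·|w|·s + |w|²` (`w = |w|(cos ψ_w, sin ψ_w)`). -/
theorem klcc_abs_transLevel_le_on_arc {w₁ w₂ ψ s θ : ℝ} {k : ℤ}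
    (hw₁ : w₁ = Real.sqrt (w₁ ^ 2 + w₂ ^ 2) * Real.cos ψ)
    (hw₂ : w₂ = Real.sqrt (w₁ ^ 2 + w₂ ^ 2) * Real.sin ψ)
    (harc : |bandNormalAngle μ θ - ψ - π / 2 - k * π| ≤ π / 2 * s) :
    |eps2 (bandX μ θ - w₁) (bandY μ θ - w₂) - μ| ≤
      Real.sqrt 2 * π * Real.sqrt (w₁ ^ 2 + w₂ ^ 2) * s + (w₁ ^ 2 + w₂ ^ 2) := by
  obtain ⟨h1, h2⟩ := B.level hμ
  set r := Real.sqrt (w₁ ^ 2 + w₂ ^ 2) with hr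
  have hr0 : 0 ≤ r := Real.sqrt_nonneg _
  obtain ⟨ρ, hρ, hx, hy⟩ := sin_bandXY_eq_polar h1 h2 θ
  obtain ⟨-, hρle⟩ := klcc_polar_rho_bounds B hμ hρ hx hy
  set α := bandNormalAngle μ θ with hα
  have hlin : w₁ * Real.sin (bandX μ θ) + w₂ * Real.sin (bandY μ θ) = ρ * r * Real.cos (α - ψ) := by
    rw [hx, hy, hw₁, hw₂, Real.cos_sub]; ring
  -- `|cos(α - ψ)| ≤ (π/2) s`
  have hcos : |Real.cos (α - ψ)| ≤ π / 2 * s := by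
    set u := α - ψ - π / 2 - k * π with hu
    have e : α - ψ = u + π / 2 + k * π := by rw [hu]; ring
    rw [e, Real.cos_add_int_mul_pi, Real.cos_add_pi_div_two, abs_mul, klcc_abs_neg_one_zpow,
      one_mul, abs_neg]
    calc |Real.sin u| = |Real.sin u - Real.sin 0| := by rw [Real.sin_zero, sub_zero]
      _ ≤ |u - 0| := Real.abs_sin_sub_sin_le _ _
      _ = |u| := by rw [sub_zero]
      _ ≤ π / 2 * s := harc
  have htaylor := klcc_transLevel_taylor h1 h2 w₁ w₂ θ
  rw [hlin] at htaylor
  have hmain : |2 * (ρ * r * Real.cos (α - ψ))| ≤ Real.sqrt 2 * π * r * s := by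
    rw [abs_mul, abs_two, abs_mul, abs_mul, abs_of_pos hρ, abs_of_nonneg hr0]
    have := mul_le_mul hρle (mul_le_mul_of_nonneg_left hcos hr0) (by positivity) (by positivity)
    nlinarith [this, Real.pi_pos, Real.sqrt_nonneg 2]
  have hsq : r ^ 2 = w₁ ^ 2 + w₂ ^ 2 := Real.sq_sqrt (by positivity)
  have htri := abs_sub_abs_le_abs_sub (eps2 (bandX μ θ - w₁) (bandY μ θ - w₂) - μ)
    (-(2 * (ρ * r * Real.cos (α - ψ))))
  rw [abs_neg, sub_neg_eq_add] at htri
  nlinarith [htri, hmain, htaylor]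

/-- **At most three intersection points near the Cooper point.** Let `w ≠ 0` be a small transfer,
`|w| ≤ ρ_min s` with `0 ≤ s < 1`, and suppose the transversality data of
`klst_slope_lower_bound` hold with a level defect `η ≥ √2·π·|w|·s + |w|²` and some `λ > 0` (in the
assembly: `r₀ = |w|_∞`, `λ ≍ |w|`). Then on every period `[θ₀, θ₀ + 2π]` the translated curve
`F_μ + w` meets `F_μ` (exactly: `ε(p_μ(z) - w) = μ`) in at most three points. Proof: a zero has
`|cos(α(z) - ψ_w)| ≤ |w|/(2ρ) ≤ s/2`, so `α(z)` is within `(π/2)s` of `ψ_w + π/2 + kπ` for an integer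
`k = k(z)`; two zeros with the same `k` would bound an arc on which `|G_w| ≤ η`, hence `|G_w'| ≥ 2λ`,
contradicting Rolle (mean value form); and `k(z)π` ranges in an interval of length `(2 + s)π`
because `α` is increasing with `α(θ₀ + 2π) = α(θ₀) + 2π`. -/
theorem klcc_zeros_card_le_three {η lam r₀ r₂ w₁ w₂ s θ₀ : ℝ}
    (hlo : a ≤ μ - η) (hhi : μ + η ≤ b)
    (hs0 : 0 ≤ s) (hs1 : s < 1)
    (hw : 0 < Real.sqrt (w₁ ^ 2 + w₂ ^ 2)) (hws : Real.sqrt (w₁ ^ 2 + w₂ ^ 2) ≤ B.rhomin * s)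
    (hη : Real.sqrt 2 * π * Real.sqrt (w₁ ^ 2 + w₂ ^ 2) * s + (w₁ ^ 2 + w₂ ^ 2) ≤ η)
    (hlam : 0 < lam)
    (hr₀ : ∀ m₀ m₁ : ℤ, r₀ ≤ max |w₁ - m₀ * (2 * π)| |w₂ - m₁ * (2 * π)|)
    (hr₂ : ∀ (m₀ m₁ : ℤ) (φ : ℝ),
      r₂ ≤ max |w₁ - m₀ * (2 * π) - 2 * bandX μ φ| |w₂ - m₁ * (2 * π) - 2 * bandY μ φ|)
    (h₀ : B.smax * (B.Cg * (lam + 2 * B.smax * (η / B.Dtmin))) + η / B.Dtmin < r₀)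
    (h₂ : B.A2 / 4 * (B.Cg * (lam + 2 * B.smax * (η / B.Dtmin))) ^ 2 + η / B.Dtmin < r₂) :
    ∃ Z : Finset ℝ, Z.card ≤ 3 ∧
      ∀ z ∈ Icc θ₀ (θ₀ + 2 * π), eps2 (bandX μ z - w₁) (bandY μ z - w₂) = μ → z ∈ Z := by
  classical
  obtain ⟨h1, h2⟩ := B.level hμ
  have hπ := Real.pi_pos
  obtain ⟨ψ, hw₁, hw₂⟩ := klcc_exists_polar hw
  have harcLevel : ∀ θ : ℝ, ∀ k : ℤ, |bandNormalAngle μ θ - ψ - π / 2 - k * π| ≤ π / 2 * s →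
      |eps2 (bandX μ θ - w₁) (bandY μ θ - w₂) - μ| ≤ η :=
    fun θ k hθ => (klcc_abs_transLevel_le_on_arc B hμ hw₁ hw₂ hθ).trans hη
  set r := Real.sqrt (w₁ ^ 2 + w₂ ^ 2) with hr
  set α := bandNormalAngle μ with hα
  have hmono : StrictMono α := strictMono_bandNormalAngle h1 h2
  -- the integer label of an angle
  have hk : ∀ z : ℝ, ∃ k : ℤ, |α z - ψ - π / 2 - k * π| ≤ π / 2 * |Real.cos (α z - ψ)| := by
    intro z
    obtain ⟨k, hk⟩ := klcc_exists_int_abs_sub_mul_pi_le (α z - ψ - π / 2)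
    refine ⟨k, ?_⟩
    rwa [Real.sin_sub_pi_div_two, abs_neg] at hk
  choose kOf hkOf using hk
  set ZS : Set ℝ := {z ∈ Icc θ₀ (θ₀ + 2 * π) | eps2 (bandX μ z - w₁) (bandY μ z - w₂) = μ} with hZS
  -- Step 1–2: at a zero, `α(z)` is within `(π/2)s` of `ψ + π/2 + kπ`
  have harc : ∀ z ∈ ZS, |α z - ψ - π / 2 - kOf z * π| ≤ π / 2 * s := by
    intro z hz
    obtain ⟨ρ, hρ, hx, hy⟩ := sin_bandXY_eq_polar h1 h2 z
    obtain ⟨hρge, -⟩ := klcc_polar_rho_bounds B hμ hρ hx hy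
    have htaylor := klcc_transLevel_taylor h1 h2 w₁ w₂ z
    have hlin : w₁ * Real.sin (bandX μ z) + w₂ * Real.sin (bandY μ z) = ρ * r * Real.cos (α z - ψ) := by
      rw [hx, hy, hw₁, hw₂, Real.cos_sub]; ring
    rw [hz.2, sub_self, zero_add, hlin] at htaylor
    -- `2 ρ r |cos| ≤ r²` hence `|cos| ≤ r/(2ρ) ≤ s/2`
    rw [abs_mul, abs_two, abs_mul, abs_mul, abs_of_pos hρ, abs_of_pos hw] at htaylor
    have hsq : r ^ 2 = w₁ ^ 2 + w₂ ^ 2 := Real.sq_sqrt (by positivity)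
    have hcos : |Real.cos (α z - ψ)| ≤ s / 2 := by
      have hc0 := abs_nonneg (Real.cos (α z - ψ))
      have h3' : r * (2 * ρ * |Real.cos (α z - ψ)|) ≤ r * r := by nlinarith [htaylor, hsq]
      have h3 : 2 * ρ * |Real.cos (α z - ψ)| ≤ r := le_of_mul_le_mul_left h3' hw
      have h4 : 2 * ρ * |Real.cos (α z - ψ)| ≤ ρ * s :=
        (h3.trans hws).trans (mul_le_mul_of_nonneg_right hρge hs0)
      have h5 : ρ * (2 * |Real.cos (α z - ψ)|) ≤ ρ * s := by linarith
      have h6 := le_of_mul_le_mul_left h5 hρ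
      linarith
    calc |α z - ψ - π / 2 - kOf z * π| ≤ π / 2 * |Real.cos (α z - ψ)| := hkOf z
      _ ≤ π / 2 * (s / 2) := by gcongr
      _ ≤ π / 2 * s := by nlinarith
  -- the derivative of `G_w` and the slope bound on arcs
  set G : ℝ → ℝ := fun t => eps2 (bandX μ t - w₁) (bandY μ t - w₂) with hG
  set G' : ℝ → ℝ := fun t =>
    2 * (Real.sin (bandX μ t - w₁) * bandVX μ t + Real.sin (bandY μ t - w₂) * bandVY μ t) with hG'
  have hGd : ∀ t, HasDerivAt G (G' t) t := fun t => klst_hasDerivAt_transLevel h1 h2 w₁ w₂ t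
  have hslope : ∀ θ : ℝ, ∀ k : ℤ, |α θ - ψ - π / 2 - k * π| ≤ π / 2 * s → 2 * lam ≤ |G' θ| := by
    intro θ k hθ
    have hlev' : |eps2 (bandX μ θ - w₁) (bandY μ θ - w₂) - μ| ≤ η := harcLevel θ k hθ
    have hlt := klst_slope_lower_bound B hμ hlo hhi hlev' hr₀ hr₂ h₀ h₂
    simp only [hG', abs_mul, abs_two]
    linarith
  -- Step 3: the label is injective on the zero set
  have hinj : InjOn (fun z => ((kOf z : ℤ) : ℝ)) ZS := by
    intro z hz z' hz' hzz'
    have hzz'' : ((kOf z : ℤ) : ℝ) = ((kOf z' : ℤ) : ℝ) := hzz'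
    have hkk : kOf z = kOf z' := by exact_mod_cast hzz''
    by_contra hne
    have key : ∀ u ∈ ZS, ∀ u' ∈ ZS, u < u' → kOf u = kOf u' → False := by
      intro u hu u' hu' huu' hk'
      have hder : ∀ t ∈ Icc u u', 2 * lam ≤ |G' t| := by
        intro t ht
        refine hslope t (kOf u) ?_
        have ha := harc u hu
        have hb := harc u' hu'
        rw [← hk'] at hb
        have hm1 : α u ≤ α t := hmono.monotone ht.1
        have hm2 : α t ≤ α u' := hmono.monotone ht.2
        rw [abs_le] at ha hb ⊢
        constructor <;> linarith [ha.1, ha.2, hb.1, hb.2]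
      have hmvt := mul_sub_le_abs_sub_of_le_abs_deriv hGd huu'.le (by linarith) hder
      have h0 : G u' - G u = 0 := by simp only [hG]; rw [hu.2, hu'.2, sub_self]
      rw [h0, abs_zero] at hmvt
      nlinarith
    rcases lt_or_gt_of_ne hne with hlt | hgt
    · exact key z hz z' hz' hlt hkk
    · exact key z' hz' z hz hgt hkk.symm
  -- Step 4: the labels lie in an interval of length `2 + s`
  set L := (α θ₀ - ψ - π / 2 - π / 2 * s) / π with hL
  set U := (α θ₀ + 2 * π - ψ - π / 2 + π / 2 * s) / π with hU
  have hUL : U - L = 2 + s := by rw [hU, hL]; field_simp; ring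
  have hLU : L ≤ U := by linarith
  have himg : (fun z => ((kOf z : ℤ) : ℝ)) '' ZS ⊆ Icc L U := by
    rintro x ⟨z, hz, rfl⟩
    have ha := harc z hz
    have hm1 : α θ₀ ≤ α z := hmono.monotone hz.1.1
    have hm2 : α z ≤ α θ₀ + 2 * π := by
      have := hmono.monotone hz.1.2
      rwa [show α (θ₀ + 2 * π) = α θ₀ + 2 * π from klcc_bandNormalAngle_add_two_pi h1 h2 θ₀] at this
    rw [abs_le] at ha
    constructor
    · rw [hL, div_le_iff₀ hπ]; linarith [ha.1, ha.2]
    · rw [hU, le_div_iff₀ hπ]; linarith [ha.1, ha.2]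
  -- Step 5: distinct labels are integers, hence `1`-separated: at most `3 + s < 4` of them
  have hsep : ∀ x ∈ (fun z => ((kOf z : ℤ) : ℝ)) '' ZS, ∀ x' ∈ (fun z => ((kOf z : ℤ) : ℝ)) '' ZS,
      x < x' → (1 : ℝ) ≤ x' - x := by
    rintro x ⟨z, -, rfl⟩ x' ⟨z', -, rfl⟩ hlt
    have hlt' : ((kOf z : ℤ) : ℝ) < ((kOf z' : ℤ) : ℝ) := hlt
    have hzz : kOf z < kOf z' := by exact_mod_cast hlt'
    have hzz1 : kOf z + 1 ≤ kOf z' := hzz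
    have hcast : ((kOf z : ℤ) : ℝ) + 1 ≤ ((kOf z' : ℤ) : ℝ) := by exact_mod_cast hzz1
    show (1 : ℝ) ≤ ((kOf z' : ℤ) : ℝ) - ((kOf z : ℤ) : ℝ)
    linarith
  obtain ⟨hKfin, hKcard⟩ := klsk_finite_ncard_le_of_separated one_pos hLU himg hsep
  rw [hUL, div_one] at hKcard
  have hZSfin : ZS.Finite := Set.Finite.of_finite_image hKfin hinj
  have hncard : ZS.ncard = ((fun z => ((kOf z : ℤ) : ℝ)) '' ZS).ncard := (hinj.ncard_image).symm
  have hle3 : ZS.ncard ≤ 3 := by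
    have h3 : (ZS.ncard : ℝ) ≤ 2 + s + 1 := by rw [hncard]; exact hKcard
    have h4 : (ZS.ncard : ℝ) < 4 := by linarith
    have h5 : ZS.ncard < 4 := by exact_mod_cast h4
    omega
  refine ⟨hZSfin.toFinset, ?_, ?_⟩
  · rw [← Set.ncard_eq_toFinset_card ZS hZSfin]; exact hle3
  · intro z hz hGz
    rw [Set.Finite.mem_toFinset]
    exact ⟨hz, hGz⟩

end Main

end Summit.HubbardSuperconductivity.HubbardSuperconductivity.Theorems

end
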